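import Summits.QuantumFields.YangMills.Theorems.BalabanUVNodesN15ContourProducts
import Summits.QuantumFields.YangMills.Theorems.BalabanUVNodesN15TwoGridAveraging
import Summits.QuantumFields.YangMills.Theorems.BalabanUVNodesN15VectorPieceBackgroundMatrix
import HarnessLib

/-!
# Route «BalabanUVNodes», node N15 = NE2, road (c) — PROGRAMME (P-Q), I: THE COVARIANT BLOCK-LINE AVERAGING `Q(U)` OF COLOURED 1-FORMS AND ITS WEIGHTED
# ADJOINT `Q*(U)` — the main term (125) of Bałaban's linearised averaging (124) ∕ the covariant form of (1.18): every fine bond value is PARALLEL-TRANSPORTED to the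
# corner of its unit block along the staircase contour `Γ_{y,x}` followed by the straight line `[x, x + s e_μ]`, then block- and line-averaged; at `U ≡ 1` the pair IS
# the tree's flat pair `(tensorId ι qvRe, tensorId ι qvAdjRe)` of the cover knit's nonlocal part `N_L = (aQ*Q − ∂Π∂*) ⊗ 1_ι`

Cell `pub-ymgap`, seat `pub-ymgap-dag-n15-c` (generation g21; R134 (a) seat, strategy s1; HUMAN RULING D-0062; chair R424 venue).  `bears_on: R4∕N15 · K3⁸ SpineGivenEndpointR13SepCoPHV
(stmt-QuantumFields-27366)`; filed `--supports stmt-QuantumFields-27366 --as helper` — COUNT-NEUTRAL.  Plumbing `def`s + [folklore] lattice algebra; 0 `sorry`, no `Prop`-valued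
definition.  Imports BY NAME, nothing in the tree modified ∕ restated: this seat's g4 `…N15ContourProducts` (`bondAt`; through it `…N15ContourSums`: `stair`, `blockCoords`,
`bpt_blockCoords`; `…N15OrderedProducts` for the lineage's ordered products), dag-n15-a parts 20∕37 `…N15AveragingStencil`∕`…N15TwoGridAveraging` (`lineWeight`, `qvRe`, `qvAdjRe`,
`qsOp_apply`, `symbOp_sA_apply`, `tstep_eq_smul`), dag-n15-c M4 `…N15VectorPieceBackgroundMatrix` (`tensorId`, `tensorId_apply`), n15-a part 8′ `kingBlockOf_bpt`.

WHY (the lane's LOCATED object (P), HOME HANDOFF g16∕g17; ref-B READ-989 item (b)(i)).  Every `NE2PlusOperator` certificate of this road (FILES 129–180) dresses Bałaban's principal part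
`Δ_{R_U}` ([Balaban1985BackgroundPropagators] (3.50) p. 400, LIVE in the background `U`) with the FLAT nonlocal part `N_L = (aQ*Q − ∂Π∂*) ⊗ 1_ι` ([Balaban1984PropagatorsI] (1.69)) in the
slot of the print's COVARIANT summand `P(U) = D_U R(U) D*_U + Q*(U)aQ(U)` ([Balaban1985BackgroundPropagators] (3.26) p. 395).  The averaging factor of that summand is the linear
part `Q(U)` of the covariant averaging operation ([Balaban1985Averaging] (121)–(125) pp. 36; [Balaban1985BackgroundPropagators] (3.13)–(3.15) p. 393): its MAIN TERM (125) is the block-line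
average (1.18) with every bond value parallel-transported to the block's base point along the contour `Γ_{y,x} ∪ [x, b₋]` («`(Q₀A)_c = Σ_{x∈B(c₋)} L^{−(d+1)} (R_{0,c₋}A)([x, x(c)])`»,
p. 36: «The first term on the right-hand side above is the main term in this linear form … The remaining terms are small … can be estimated by O(L²α₀)»).  THIS FILE types that main term on
the lane's carriers: fine coloured 1-forms `((Tor (fine n M) × Fin (d+1)) × ι → ℝ)`, coarse ones `((Tor M × Fin (d+1)) × ι → ℝ)`, the one-bond transporters given as a DATUM
`T : Fin (d+1) → Tor (fine n M) × Fin (d+1) → Matrix ι ι ℝ` (the coordinate matrices of `Ad_{U(b)}` in a basis `e` of `𝔤` — the sequel instantiates `T μ p = coordMat e Ad_{U μ p}`; at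
`U ≡ 1`, `T ≡ 1`), with the adjoint weighted by `n^{d+1}` exactly as the flat `qvAdjRe = n^{d+1}·Qᴴ` of part 37 (so that `a·Q*(U)Q(U)` replaces `a·Q*Q ⊗ 1_ι` term by term).

OBJECTS AND RESULTS ([folklore] unless tagged; the (125)∕(1.18) tags mark which printed formula the objects transcribe — nothing printed is asserted).
* §1 `mprod` — ordered products in a monoid (`mprod F N = F 0 ⋯ F (N−1)`; instance-free twin of the lineage's `B7Prop6Bound.oprod`, to which it is equal in any normed ring:
  `mprod_eq_oprod`), `mprod_zero∕succ∕add∕congr∕one`, `transpose_mprod` (`(Π F)ᵀ = Π` of the transposes in reverse order).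
* §2 the transports: `cvaLeg` (one leg of the staircase), `cvaStair` (the staircase `Γ_{y,x}` from the block's base point), `cvaLine` (the straight line `[x, x + s e_μ]`),
  ★ `cvaPath = cvaStair · cvaLine` (the transport of (125)); `…_one` (all `= 1` at `T ≡ 1`).
* §3 `qvKer W`∕`qvAdjKer W` (the (1.18)-shaped average ∕ stencil with an arbitrary matrix path kernel `W`; `qvKer_sub`, `qvAdjKer_sub`), ★ **`qvCov T`** (`W = cvaPath T`) — `(Q_T u)((y, μ), i) = n^{−(d+1)} Σ_{x ∈ B(y)} n⁻¹ Σ_{s<n} Σ_j (cvaPath T (x, μ) s)_{ij} · u((x + s e_μ, μ), j)`; ★ **`qvCovAdj T`** — `(Q*_T v)((x′, κ), j) =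
  n⁻¹ Σ_{s<n} Σ_i (cvaPath T (x′ − s e_κ, κ) s)_{ij} · v((B(x′ − s e_κ), κ), i)` (= `n^{d+1}·Q_Tᵀ`, the colour index transposed with the kernel); `qvCov_apply`, `qvCovAdj_apply`, `qvCov_sub_qvCov_one`, `qvCovAdj_sub_qvCovAdj_one`.
* §4 ★★ **`qvCov_one : qvCov M n 1 = tensorId ι (qvRe M n)`**, ★★ **`qvCovAdj_one : qvCovAdj M n 1 = tensorId ι (qvAdjRe M n)`** — at `U ≡ 1` the covariant pair IS the flat pair of the
  cover knit's `N_L` (part 37's `qsOp_apply`∕`symbOp_sA_apply`; part 20's line-weight stencil `lineWeight` counted out).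

HONEST FRAMING ∕ LIMITS.  Definitions + finite lattice algebra; NO estimate (the letters are the sequel `…N15CovariantAveragingLetters`).  MODEL READING: the MAIN TERM (125) of
[Balaban1985Averaging] (124) only — the `O(L²α₀)` correction terms of (124) (functions `g(−z)`, `g⁻¹(z)`, `e^{iz}` of the block field `Y`) are OMITTED; ONE-LEVEL staircase contour from
the block's base point (b05's `bpt y 0`), not the multi-level contours of (3.55); the transporters are an abstract matrix datum (component-dependent `T μ (x, ν)` allowed, as everywhere on
this road); the `D_U R(U) D*_U` summand of (3.26) is NOT here (N06's Thms 3.1–3.3 lane).  NE2⁺ NOT PRINTED; N15 of record untouched (DISCHARGED AS CONSUMED, p687738); counts UNMOVED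
(typed 28∕28); one finite 𝕋⁴ at fixed ε per index — NOT infinite volume ∕ OS ∕ mass gap ∕ Clay.  Restate-immune (no Theses import).
-/

noncomputable section

open scoped BigOperators Matrix
open Finset

namespace Summit.QuantumFields.YangMills.BalabanUVNodes.N15.CovAvg

open Literature.MathematicalPhysics.QuantumFieldTheory.Balaban1983to89
open Literature.MathematicalPhysics.QuantumFieldTheory.Balaban1983to89.B5Prop11Plancherel (Tor fine unitVec)
open Literature.MathematicalPhysics.QuantumFieldTheory.Balaban1983to89.B5Block118 (bpt tstep)
open Literature.MathematicalPhysics.QuantumFieldTheory.Balaban1983to89.B7Prop6Bound (oprod)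
open Literature.MathematicalPhysics.QuantumFieldTheory.Balaban1983to89.T4EtaRateCoeffDefect (fibre mem_fibre)
open Literature.MathematicalPhysics.QuantumFieldTheory.King1986.Torus (blockOf)
open Summit.QuantumFields.YangMills.BalabanUVNodes.N15.VectorPiece (bondAt blockCoords bpt_blockCoords tensorId tensorId_apply lineWeight oprod_succ)
open Summit.QuantumFields.YangMills.BalabanUVNodes.N15.TwoGrid (qvRe qvAdjRe qvRe_apply qvAdjRe_apply qsOp_apply symbOp_sA_apply tstep_eq_smul)
open Summit.QuantumFields.YangMills.BalabanUVNodes.N15.DefectKernel (kingBlockOf_bpt)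

variable {d : ℕ}

/-! ## §1 Ordered products in a monoid -/

section MProd

variable {R : Type} [Monoid R]

/-- ORDERED PRODUCT in a monoid: `mprod F N = F 0 · F 1 ⋯ F (N−1)` (the instance-free twin of the lineage's `B7Prop6Bound.oprod`). [folklore] -/
def mprod (F : ℕ → R) : ℕ → R
  | 0 => 1
  | N + 1 => mprod F N * F N

/-- The empty product. [folklore] -/
@[simp] theorem mprod_zero (F : ℕ → R) : mprod F 0 = 1 := rfl

/-- One more factor on the right. [folklore] -/
theorem mprod_succ (F : ℕ → R) (N : ℕ) : mprod F (N + 1) = mprod F N * F N := rfl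

/-- Products of pointwise-equal factor lists agree. [folklore] -/
theorem mprod_congr {F G : ℕ → R} {N : ℕ} (h : ∀ i < N, F i = G i) : mprod F N = mprod G N := by
  induction N with
  | zero => rfl
  | succ N ih => rw [mprod_succ, mprod_succ, ih (fun i hi => h i (Nat.lt_succ_of_lt hi)), h N (Nat.lt_succ_self N)]

/-- Splitting: `Π_{i<N+K} F_i = (Π_{i<N} F_i)·(Π_{i<K} F_{N+i})`. [folklore] -/
theorem mprod_add (F : ℕ → R) (N K : ℕ) : mprod F (N + K) = mprod F N * mprod (fun i => F (N + i)) K := by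
  induction K with
  | zero => simp
  | succ K ih => rw [Nat.add_succ, mprod_succ, ih, mprod_succ, mul_assoc]

/-- A product of `1`s is `1`. [folklore] -/
theorem mprod_one (N : ℕ) : mprod (fun _ : ℕ => (1 : R)) N = 1 := by
  induction N with
  | zero => rfl
  | succ N ih => rw [mprod_succ, ih, one_mul]

/-- A product all of whose factors are `1` is `1`. [folklore] -/
theorem mprod_eq_one {F : ℕ → R} {N : ℕ} (h : ∀ i < N, F i = 1) : mprod F N = 1 :=
  (mprod_congr h).trans (mprod_one N)

/-- In a normed ring `mprod` IS the lineage's `oprod` (so its norm lemmas apply). [folklore] -/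
theorem mprod_eq_oprod {A : Type} [NormedRing A] (F : ℕ → A) (N : ℕ) : mprod F N = oprod F N := by
  induction N with
  | zero => rfl
  | succ N ih => rw [mprod_succ, oprod_succ, ih]

/-- TRANSPOSE OF AN ORDERED PRODUCT of square matrices: the product of the transposes in REVERSE order. [folklore] -/
theorem transpose_mprod {ι : Type} [Fintype ι] [DecidableEq ι] {S : Type} [CommSemiring S] (F : ℕ → Matrix ι ι S) (N : ℕ) :
    (mprod F N)ᵀ = mprod (fun t => (F (N - 1 - t))ᵀ) N := by
  induction N with
  | zero => simp
  | succ N ih =>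
      rw [mprod_succ, Matrix.transpose_mul, ih, show N + 1 = 1 + N from Nat.add_comm _ _, mprod_add, show mprod (fun t => (F (1 + N - 1 - t))ᵀ) 1 = (F N)ᵀ by
        rw [show (1 : ℕ) = 0 + 1 from rfl, mprod_succ, mprod_zero, one_mul]; simp]
      congr 1
      exact mprod_congr fun i hi => by congr 2; omega

end MProd

/-! ## §2 The parallel transports along the staircase and the line -/

section Transport

variable (M : Fin (d + 1) → ℕ) [∀ μ, NeZero (M μ)] (n : ℕ) [NeZero n] {ι : Type} [Fintype ι] [DecidableEq ι]

/-- ONE LEG of the staircase transport: `Π_{t < a_μ} T_μ(b_{μ,t})` along leg `μ` of the staircase to `n·y + a`, on the `ν`-slice of the carrier.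
[cite: Balaban1985Averaging, (125) p.36 («R_{0,c₋}»: the transport to the block's base point, shape)] -/
def cvaLeg (T : Fin (d + 1) → Tor (fine n M) × Fin (d + 1) → Matrix ι ι ℝ) (y : Tor M) (a : Fin (d + 1) → Fin n) (μ ν : Fin (d + 1)) : Matrix ι ι ℝ :=
  mprod (fun t => T μ (bondAt n M y a μ ν t)) (a μ)

/-- THE STAIRCASE TRANSPORT `T(Γ_{y,x})` from the block's base point `n·y` to `x = n·y + a`: the legs in coordinate order. [cite: Balaban1985Averaging, (125) p.36 (shape)] -/
def cvaStair (T : Fin (d + 1) → Tor (fine n M) × Fin (d + 1) → Matrix ι ι ℝ) (y : Tor M) (a : Fin (d + 1) → Fin n) (ν : Fin (d + 1)) : Matrix ι ι ℝ :=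
  mprod (fun i => if h : i < d + 1 then cvaLeg M n T y a ⟨i, h⟩ ν else 1) (d + 1)

/-- THE LINE TRANSPORT `T([x, x + s e_μ])` along `s` bonds in the 1-form's own direction `μ = p.2`. [cite: Balaban1984PropagatorsI, (1.18) p.20 («A([x, x(b)])»: shape)] -/
def cvaLine (T : Fin (d + 1) → Tor (fine n M) × Fin (d + 1) → Matrix ι ι ℝ) (p : Tor (fine n M) × Fin (d + 1)) (s : ℕ) : Matrix ι ι ℝ :=
  mprod (fun t => T p.2 (p.1 + t • unitVec (fine n M) p.2, p.2)) s

/-- ★ THE TRANSPORT OF (125): staircase from the base point of `p`'s block to `p`, then `s` steps along the line. [cite: Balaban1985Averaging, (125) p.36 (shape)] -/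
def cvaPath (T : Fin (d + 1) → Tor (fine n M) × Fin (d + 1) → Matrix ι ι ℝ) (p : Tor (fine n M) × Fin (d + 1)) (s : ℕ) : Matrix ι ι ℝ :=
  cvaStair M n T (blockCoords n M p.1).1 (blockCoords n M p.1).2 p.2 * cvaLine M n T p s

omit [∀ μ, NeZero (M μ)] in
/-- At `T ≡ 1` every leg is `1`. [folklore] -/
theorem cvaLeg_one (y : Tor M) (a : Fin (d + 1) → Fin n) (μ ν : Fin (d + 1)) : cvaLeg M n (fun _ _ => (1 : Matrix ι ι ℝ)) y a μ ν = 1 :=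
  mprod_one _

omit [∀ μ, NeZero (M μ)] in
/-- At `T ≡ 1` the staircase transport is `1`. [folklore] -/
theorem cvaStair_one (y : Tor M) (a : Fin (d + 1) → Fin n) (ν : Fin (d + 1)) : cvaStair M n (fun _ _ => (1 : Matrix ι ι ℝ)) y a ν = 1 :=
  mprod_eq_one fun i _ => by (split_ifs; simp [cvaLeg_one])

omit [∀ μ, NeZero (M μ)] [NeZero n] in
/-- At `T ≡ 1` the line transport is `1`. [folklore] -/
theorem cvaLine_one (p : Tor (fine n M) × Fin (d + 1)) (s : ℕ) : cvaLine M n (fun _ _ => (1 : Matrix ι ι ℝ)) p s = 1 :=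
  mprod_one _

/-- At `T ≡ 1` the transport of (125) is `1`. [folklore] -/
theorem cvaPath_one (p : Tor (fine n M) × Fin (d + 1)) (s : ℕ) : cvaPath M n (fun _ _ => (1 : Matrix ι ι ℝ)) p s = 1 := by
  rw [cvaPath, cvaStair_one, cvaLine_one, one_mul]

end Transport

/-! ## §3 The covariant block-line average and its weighted adjoint -/

section Average

variable (M : Fin (d + 1) → ℕ) [∀ μ, NeZero (M μ)] (n : ℕ) [NeZero n] {ι : Type} [Fintype ι] [DecidableEq ι]

/-- THE BLOCK-LINE AVERAGE WITH A MATRIX PATH KERNEL `W` (the (1.18)-shaped operator whose bond value at `x + s e_μ` is weighted by the matrix `W (x, μ) s`; `Q(U)` is the case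
`W = cvaPath T`, and differences of such operators are the same shape with the difference kernel):
`(Q_W u)((y, μ), i) = n^{−(d+1)} Σ_{x ∈ B(y)} n⁻¹ Σ_{s<n} Σ_j (W (x, μ) s)_{ij} · u((x + s e_μ, μ), j)`. [cite: Balaban1984PropagatorsI, (1.18) p.20 (shape)] -/
def qvKer (W : Tor (fine n M) × Fin (d + 1) → ℕ → Matrix ι ι ℝ) :
    ((Tor (fine n M) × Fin (d + 1)) × ι → ℝ) →ₗ[ℝ] ((Tor M × Fin (d + 1)) × ι → ℝ) where
  toFun u := fun q => ((n : ℝ) ^ (d + 1))⁻¹ * ∑ x ∈ fibre (blockOf n M) q.1.1,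
    ((n : ℝ)⁻¹ * ∑ s ∈ range n, ∑ j, W (x, q.1.2) s q.2 j * u ((x + s • unitVec (fine n M) q.1.2, q.1.2), j))
  map_add' u v := by
    funext q
    simp only [Pi.add_apply, mul_add, sum_add_distrib]
  map_smul' c u := by
    funext q
    simp only [Pi.smul_apply, smul_eq_mul, RingHom.id_apply, mul_sum]
    refine sum_congr rfl fun x _ => sum_congr rfl fun s _ => sum_congr rfl fun j _ => by ring

omit [DecidableEq ι] in
/-- Pointwise form. [folklore] -/
theorem qvKer_apply (W : Tor (fine n M) × Fin (d + 1) → ℕ → Matrix ι ι ℝ) (u : (Tor (fine n M) × Fin (d + 1)) × ι → ℝ) (q : (Tor M × Fin (d + 1)) × ι) :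
    qvKer M n W u q = ((n : ℝ) ^ (d + 1))⁻¹ * ∑ x ∈ fibre (blockOf n M) q.1.1,
      ((n : ℝ)⁻¹ * ∑ s ∈ range n, ∑ j, W (x, q.1.2) s q.2 j * u ((x + s • unitVec (fine n M) q.1.2, q.1.2), j)) := rfl

omit [DecidableEq ι] in
/-- The kernel enters linearly: `Q_{W₁} − Q_{W₂} = Q_{W₁ − W₂}`. [folklore] -/
theorem qvKer_sub (W₁ W₂ : Tor (fine n M) × Fin (d + 1) → ℕ → Matrix ι ι ℝ) : qvKer M n W₁ - qvKer M n W₂ = qvKer M n (W₁ - W₂) := by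
  refine LinearMap.ext fun u => funext fun q => ?_
  rw [LinearMap.sub_apply, Pi.sub_apply, qvKer_apply, qvKer_apply, qvKer_apply, ← mul_sub, ← sum_sub_distrib]
  refine congrArg _ (sum_congr rfl fun x _ => ?_)
  rw [← mul_sub, ← sum_sub_distrib]
  refine congrArg _ (sum_congr rfl fun s _ => ?_)
  rw [← sum_sub_distrib]
  exact sum_congr rfl fun j _ => by rw [Pi.sub_apply, Pi.sub_apply, Matrix.sub_apply, sub_mul]

/-- THE WEIGHTED ADJOINT SHAPE WITH A MATRIX PATH KERNEL `W` (`= n^{d+1}·Q_Wᵀ`, the colour index transposed with the kernel):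
`(Q*_W v)((x′, κ), j) = n⁻¹ Σ_{s<n} Σ_i (W (x′ − s e_κ, κ) s)_{ij} · v((B(x′ − s e_κ), κ), i)`. [cite: Balaban1984PropagatorsI, (1.18) p.20, (1.69) p.29 («Q*»: shape)] -/
def qvAdjKer (W : Tor (fine n M) × Fin (d + 1) → ℕ → Matrix ι ι ℝ) :
    ((Tor M × Fin (d + 1)) × ι → ℝ) →ₗ[ℝ] ((Tor (fine n M) × Fin (d + 1)) × ι → ℝ) where
  toFun v := fun p => (n : ℝ)⁻¹ * ∑ s ∈ range n, ∑ i, W (p.1.1 - s • unitVec (fine n M) p.1.2, p.1.2) s i p.2 *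
    v ((blockOf n M (p.1.1 - s • unitVec (fine n M) p.1.2), p.1.2), i)
  map_add' u v := by
    funext p
    simp only [Pi.add_apply, mul_add, sum_add_distrib]
  map_smul' c u := by
    funext p
    simp only [Pi.smul_apply, smul_eq_mul, RingHom.id_apply, mul_sum]
    refine sum_congr rfl fun s _ => sum_congr rfl fun i _ => by ring

omit [DecidableEq ι] in
/-- Pointwise form. [folklore] -/
theorem qvAdjKer_apply (W : Tor (fine n M) × Fin (d + 1) → ℕ → Matrix ι ι ℝ) (v : (Tor M × Fin (d + 1)) × ι → ℝ) (p : (Tor (fine n M) × Fin (d + 1)) × ι) :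
    qvAdjKer M n W v p = (n : ℝ)⁻¹ * ∑ s ∈ range n, ∑ i, W (p.1.1 - s • unitVec (fine n M) p.1.2, p.1.2) s i p.2 *
      v ((blockOf n M (p.1.1 - s • unitVec (fine n M) p.1.2), p.1.2), i) := rfl

omit [DecidableEq ι] in
/-- The kernel enters linearly: `Q*_{W₁} − Q*_{W₂} = Q*_{W₁ − W₂}`. [folklore] -/
theorem qvAdjKer_sub (W₁ W₂ : Tor (fine n M) × Fin (d + 1) → ℕ → Matrix ι ι ℝ) : qvAdjKer M n W₁ - qvAdjKer M n W₂ = qvAdjKer M n (W₁ - W₂) := by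
  refine LinearMap.ext fun v => funext fun p => ?_
  rw [LinearMap.sub_apply, Pi.sub_apply, qvAdjKer_apply, qvAdjKer_apply, qvAdjKer_apply, ← mul_sub, ← sum_sub_distrib]
  refine congrArg _ (sum_congr rfl fun s _ => ?_)
  rw [← sum_sub_distrib]
  exact sum_congr rfl fun i _ => by rw [Pi.sub_apply, Pi.sub_apply, Matrix.sub_apply, sub_mul]

/-- ★ **THE COVARIANT BLOCK-LINE AVERAGE `Q(U)` OF COLOURED 1-FORMS** (main term (125) of [Balaban1985Averaging] (124); the covariant form of [Balaban1984PropagatorsI] (1.18)):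
`(Q_T u)((y, μ), i) = n^{−(d+1)} Σ_{x ∈ B(y)} n⁻¹ Σ_{s<n} Σ_j (cvaPath T (x, μ) s)_{ij} · u((x + s e_μ, μ), j)` — every bond value transported to the base point of the block of `y`.
[cite: Balaban1985Averaging, (125) p.36; Balaban1984PropagatorsI, (1.18) p.20] -/
def qvCov (T : Fin (d + 1) → Tor (fine n M) × Fin (d + 1) → Matrix ι ι ℝ) :
    ((Tor (fine n M) × Fin (d + 1)) × ι → ℝ) →ₗ[ℝ] ((Tor M × Fin (d + 1)) × ι → ℝ) :=
  qvKer M n (cvaPath M n T)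

/-- Pointwise form of `Q(U)`. [folklore] -/
theorem qvCov_apply (T : Fin (d + 1) → Tor (fine n M) × Fin (d + 1) → Matrix ι ι ℝ) (u : (Tor (fine n M) × Fin (d + 1)) × ι → ℝ) (q : (Tor M × Fin (d + 1)) × ι) :
    qvCov M n T u q = ((n : ℝ) ^ (d + 1))⁻¹ * ∑ x ∈ fibre (blockOf n M) q.1.1,
      ((n : ℝ)⁻¹ * ∑ s ∈ range n, ∑ j, cvaPath M n T (x, q.1.2) s q.2 j * u ((x + s • unitVec (fine n M) q.1.2, q.1.2), j)) := rfl

/-- ★ **THE WEIGHTED ADJOINT `Q*(U) = n^{d+1}·Q(U)ᵀ`** (the covariant form of part 37's line-weight stencil `qvAdjRe`): the fine point `x′` receives from the coarse sites `B(x′ − s e_κ)`,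
`s < n`, through the transport with the colour index transposed: `(Q*_T v)((x′, κ), j) = n⁻¹ Σ_{s<n} Σ_i (cvaPath T (x′ − s e_κ, κ) s)_{ij} · v((B(x′ − s e_κ), κ), i)`.
[cite: Balaban1984PropagatorsI, (1.18) p.20, (1.69) p.29 («Q*»); Balaban1985Averaging, (125) p.36] -/
def qvCovAdj (T : Fin (d + 1) → Tor (fine n M) × Fin (d + 1) → Matrix ι ι ℝ) :
    ((Tor M × Fin (d + 1)) × ι → ℝ) →ₗ[ℝ] ((Tor (fine n M) × Fin (d + 1)) × ι → ℝ) :=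
  qvAdjKer M n (cvaPath M n T)

/-- Pointwise form of `Q*(U)`. [folklore] -/
theorem qvCovAdj_apply (T : Fin (d + 1) → Tor (fine n M) × Fin (d + 1) → Matrix ι ι ℝ) (v : (Tor M × Fin (d + 1)) × ι → ℝ) (p : (Tor (fine n M) × Fin (d + 1)) × ι) :
    qvCovAdj M n T v p = (n : ℝ)⁻¹ * ∑ s ∈ range n, ∑ i, cvaPath M n T (p.1.1 - s • unitVec (fine n M) p.1.2, p.1.2) s i p.2 *
      v ((blockOf n M (p.1.1 - s • unitVec (fine n M) p.1.2), p.1.2), i) := rfl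

/-- `Q(U) − Q(1)` is the same average with the kernel `cvaPath T − 1`. [folklore] -/
theorem qvCov_sub_qvCov_one (T : Fin (d + 1) → Tor (fine n M) × Fin (d + 1) → Matrix ι ι ℝ) :
    qvCov M n T - qvCov M n (fun _ _ => 1) = qvKer M n (fun p s => cvaPath M n T p s - 1) := by
  rw [qvCov, qvCov, qvKer_sub]
  congr 1
  funext p s
  rw [Pi.sub_apply, Pi.sub_apply, cvaPath_one]

/-- `Q*(U) − Q*(1)` is the same stencil with the kernel `cvaPath T − 1`. [folklore] -/
theorem qvCovAdj_sub_qvCovAdj_one (T : Fin (d + 1) → Tor (fine n M) × Fin (d + 1) → Matrix ι ι ℝ) :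
    qvCovAdj M n T - qvCovAdj M n (fun _ _ => 1) = qvAdjKer M n (fun p s => cvaPath M n T p s - 1) := by
  rw [qvCovAdj, qvCovAdj, qvAdjKer_sub]
  congr 1
  funext p s
  rw [Pi.sub_apply, Pi.sub_apply, cvaPath_one]

end Average

/-! ## §4 At `U ≡ 1` the covariant pair is the flat pair of `N_L` -/

section Flat

variable (M : Fin (d + 1) → ℕ) [∀ μ, NeZero (M μ)] (n : ℕ) [NeZero n] {ι : Type} [Fintype ι] [DecidableEq ι]

/-- The identity kernel collapses the colour sum: `Σ_j 1_{ij}·f j = f i`. [folklore] -/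
theorem sum_one_apply_mul (f : ι → ℝ) (i : ι) : ∑ j, (1 : Matrix ι ι ℝ) i j * f j = f i := by
  simp [Matrix.one_apply]

/-- The identity kernel collapses the colour sum (transposed index): `Σ_i 1_{ij}·f i = f j`. [folklore] -/
theorem sum_one_apply_mul' (f : ι → ℝ) (j : ι) : ∑ i, (1 : Matrix ι ι ℝ) i j * f i = f j := by
  simp [Matrix.one_apply]

/-- ★★ **AT `U ≡ 1`, `Q(U)` IS THE FLAT `Q ⊗ 1_ι`** of the cover knit's `N_L` (part 37's `qvRe = Q^s∘ρ(a_μ(n))`, componentwise in the colour). [cite: Balaban1984PropagatorsI, (1.18) p.20] -/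
theorem qvCov_one : qvCov M n (fun _ _ => (1 : Matrix ι ι ℝ)) = tensorId ι (qvRe M n) := by
  refine LinearMap.ext fun u => funext fun q => ?_
  obtain ⟨⟨y, μ⟩, i⟩ := q
  rw [qvCov_apply, tensorId_apply, qvRe_apply, qsOp_apply]
  refine congrArg _ (sum_congr rfl fun x _ => ?_)
  rw [symbOp_sA_apply]
  refine congrArg _ (sum_congr rfl fun s _ => ?_)
  rw [cvaPath_one, sum_one_apply_mul]

/-- The line-weight stencil counted out: `n·θ_n(x, z; κ) = #{s < n : B(x − s e_κ) = z}` as a sum of indicators over `s < n`. [folklore] -/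
theorem lineWeight_eq_inv_mul_sum (κ : Fin (d + 1)) (x : Tor (fine n M)) (z : Tor M) :
    lineWeight n M κ x z = (n : ℝ)⁻¹ * ∑ s ∈ range n, if blockOf n M (x - s • unitVec (fine n M) κ) = z then (1 : ℝ) else 0 := by
  classical
  have hn : (n : ℝ) ≠ 0 := Nat.cast_ne_zero.mpr (NeZero.ne n)
  rw [eq_inv_mul_iff_mul_eq₀ hn]
  unfold lineWeight
  rw [mul_comm, div_mul_cancel₀ _ hn, Finset.card_filter, Nat.cast_sum]
  simp only [Nat.cast_ite, Nat.cast_one, Nat.cast_zero]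
  rw [Fin.sum_univ_eq_sum_range (fun t => if blockOf n M (x - tstep (fine n M) κ t) = z then (1 : ℝ) else 0) n]
  exact sum_congr rfl fun s _ => by rw [tstep_eq_smul]

/-- ★★ **AT `U ≡ 1`, `Q*(U)` IS THE FLAT `Q* ⊗ 1_ι`** (part 37's line-weight stencil `qvAdjRe`: `θ_n(x′, z; κ) = #{s < n : B(x′ − s e_κ) = z}∕n`). [cite: Balaban1984PropagatorsI, (1.18) p.20, (1.69) p.29] -/
theorem qvCovAdj_one : qvCovAdj M n (fun _ _ => (1 : Matrix ι ι ℝ)) = tensorId ι (qvAdjRe M n) := by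
  classical
  refine LinearMap.ext fun v => funext fun p => ?_
  obtain ⟨⟨x, κ⟩, j⟩ := p
  rw [qvCovAdj_apply, tensorId_apply, qvAdjRe_apply]
  simp only [cvaPath_one, sum_one_apply_mul']
  symm
  calc ∑ z : Tor M, lineWeight n M κ x z * (fun b => v (b, j)) (z, κ)
      = ∑ z : Tor M, ∑ s ∈ range n, (n : ℝ)⁻¹ * ((if blockOf n M (x - s • unitVec (fine n M) κ) = z then (1 : ℝ) else 0) * v ((z, κ), j)) :=
        sum_congr rfl fun z _ => by rw [lineWeight_eq_inv_mul_sum, mul_assoc, sum_mul, mul_sum]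
    _ = ∑ s ∈ range n, ∑ z : Tor M, (n : ℝ)⁻¹ * ((if blockOf n M (x - s • unitVec (fine n M) κ) = z then (1 : ℝ) else 0) * v ((z, κ), j)) := sum_comm
    _ = ∑ s ∈ range n, (n : ℝ)⁻¹ * v ((blockOf n M (x - s • unitVec (fine n M) κ), κ), j) := by
        refine sum_congr rfl fun s _ => ?_
        rw [← mul_sum]
        congr 1
        simp only [ite_mul, one_mul, zero_mul, sum_ite_eq, mem_univ, if_true]
    _ = (n : ℝ)⁻¹ * ∑ s ∈ range n, v ((blockOf n M (x - s • unitVec (fine n M) κ), κ), j) := by rw [← mul_sum]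

end Flat

end Summit.QuantumFields.YangMills.BalabanUVNodes.N15.CovAvg

end
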